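import Literature.MathematicalPhysics.QuantumLattice.HubbardFreeCovariance

/-!
# drefute support: the symmetric Matsubara truncation carries the MIDPOINT equal-time value

For the tree's frequency set `ω_i = π(2n+1)/β`, `n = i - M ∈ {-M,…,M-1}` (`MatsubaraIdx M`,
`matsubaraFreq_rev : ω_{rev i} = -ω_i`), the truncated equal-time "density loop"
`Σ_i 1/(iω_i - ξ)` of a mode of energy `ξ` is REAL and equals `-ξ Σ_i 1/(ω_i² + ξ²)`; in particular it
VANISHES IDENTICALLY at `ξ = 0` for every `M` (whereas the operator value `β⟨c†c⟩ = β n_F(0) = β/2`).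
As `M → ∞` it tends to `-(β/2) tanh(βξ/2) = β (n_F(ξ) - ½)`: Hartree loops of the plain quartic vertex
`hubbardInteraction` come out as `U(n_σ - ½)`, i.e. the Grassmann objects at chemical potential `μ`
describe the operator model `dWaveSourceTorus L U (μ + U/2) h` (frame note X1 / ATTACK_14045).
-/

open Literature.MathematicalPhysics.QuantumLattice Finset

namespace DrefuteTadpole

/-- Pairing `i ↔ rev i`: a sum over the symmetric frequency set is invariant under `ω ↦ -ω`. -/
theorem sum_matsubara_reflect {α : Type*} [AddCommMonoid α] (β : ℝ) (M : ℕ) (f : ℝ → α) :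
    ∑ i : MatsubaraIdx M, f (matsubaraFreq β M i) = ∑ i : MatsubaraIdx M, f (-matsubaraFreq β M i) := by
  refine Fintype.sum_equiv Fin.revPerm _ _ fun i => ?_
  simp [Fin.revPerm_apply, matsubaraFreq_rev]

/-- **The truncated tadpole at `ξ = 0` is exactly zero for every `M`** (no Fermi-function information). -/
theorem tadpole_zero (β : ℝ) (M : ℕ) :
    ∑ i : MatsubaraIdx M, (1 : ℂ) / (Complex.I * (matsubaraFreq β M i : ℂ)) = 0 := by
  have h := sum_matsubara_reflect β M (fun ω => (1 : ℂ) / (Complex.I * (ω : ℂ)))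
  simp only [Complex.ofReal_neg, mul_neg, div_neg, Finset.sum_neg_distrib] at h
  -- h : S = -S
  linear_combination (1 / 2 : ℂ) * h

/-- Pointwise: `1/(iω - ξ) + 1/(-iω - ξ) = -2ξ/(ω² + ξ²)` (also at the junk points). -/
theorem pair_identity (ω ξ : ℝ) :
    (1 : ℂ) / (Complex.I * ω - ξ) + 1 / (-(Complex.I * ω) - ξ) = ((-2 * ξ / (ω ^ 2 + ξ ^ 2) : ℝ) : ℂ) := by
  rcases eq_or_ne (ω ^ 2 + ξ ^ 2) 0 with h0 | h0
  · have hω : ω = 0 := by nlinarith [sq_nonneg ω, sq_nonneg ξ]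
    have hξ : ξ = 0 := by nlinarith [sq_nonneg ω, sq_nonneg ξ]
    simp [hω, hξ]
  · have h1 : (Complex.I * ω - ξ) ≠ 0 := by
      intro h
      have := congrArg Complex.normSq h
      simp [Complex.normSq_apply] at this
      apply h0; nlinarith [sq_nonneg ω, sq_nonneg ξ]
    have h2 : (-(Complex.I * ω) - (ξ : ℂ)) ≠ 0 := by
      intro h
      have := congrArg Complex.normSq h
      simp [Complex.normSq_apply] at this
      apply h0; nlinarith [sq_nonneg ω, sq_nonneg ξ]
    have h0' : ((ω : ℂ) ^ 2 + (ξ : ℂ) ^ 2) ≠ 0 := by exact_mod_cast h0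
    push_cast
    field_simp
    ring_nf
    simp [Complex.I_sq]

/-- **The truncated density loop is real**: `Σ_i 1/(iω_i - ξ) = -ξ Σ_i 1/(ω_i² + ξ²)` (an even, real
function of the frequencies; odd in `ξ`), for every `β`, `M`, `ξ`. -/
theorem tadpole_eq_real (β : ℝ) (M : ℕ) (ξ : ℝ) :
    ∑ i : MatsubaraIdx M, (1 : ℂ) / (Complex.I * (matsubaraFreq β M i : ℂ) - ξ) =
      ((∑ i : MatsubaraIdx M, -ξ / (matsubaraFreq β M i ^ 2 + ξ ^ 2) : ℝ) : ℂ) := by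
  have h := sum_matsubara_reflect β M (fun ω => (1 : ℂ) / (Complex.I * (ω : ℂ) - ξ))
  have h2 : 2 * ∑ i : MatsubaraIdx M, (1 : ℂ) / (Complex.I * (matsubaraFreq β M i : ℂ) - ξ) =
      ∑ i : MatsubaraIdx M, ((1 : ℂ) / (Complex.I * (matsubaraFreq β M i : ℂ) - ξ) +
        1 / (-(Complex.I * (matsubaraFreq β M i : ℂ)) - ξ)) := by
    rw [Finset.sum_add_distrib, two_mul]
    congr 1
    simpa [Complex.ofReal_neg, mul_neg] using h
  have h3 : ∑ i : MatsubaraIdx M, ((1 : ℂ) / (Complex.I * (matsubaraFreq β M i : ℂ) - ξ) +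
        1 / (-(Complex.I * (matsubaraFreq β M i : ℂ)) - ξ)) =
      ∑ i : MatsubaraIdx M, (((-2 * ξ / (matsubaraFreq β M i ^ 2 + ξ ^ 2) : ℝ) : ℂ)) :=
    Finset.sum_congr rfl fun i _ => pair_identity _ _
  rw [h3] at h2
  push_cast at h2 ⊢
  have : ∑ i : MatsubaraIdx M, (-2 * (ξ : ℂ) / ((matsubaraFreq β M i : ℂ) ^ 2 + (ξ : ℂ) ^ 2)) =
      2 * ∑ i : MatsubaraIdx M, (-(ξ : ℂ) / ((matsubaraFreq β M i : ℂ) ^ 2 + (ξ : ℂ) ^ 2)) := by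
    rw [Finset.mul_sum]; refine Finset.sum_congr rfl fun i _ => ?_; ring
  rw [this] at h2
  have h4 := mul_left_cancel₀ (two_ne_zero' ℂ) h2
  exact h4

end DrefuteTadpole
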